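import Summits.ResolutionOfSingularities.ResolutionOfSingularities.Theorems.FrobeniusLadderFInjectiveMacaulayficationGradedDomainConeFiModel
import Summits.ResolutionOfSingularities.ResolutionOfSingularities.Theorems.FrobeniusLadderFInjectiveMacaulayficationPConeVeroneseSplitting
import Summits.ResolutionOfSingularities.ResolutionOfSingularities.Theorems.FrobeniusLadderFInjectiveMacaulayficationPConePrime
import HarnessLib

/-!
# G6ᵍ-P: the graded engine on the codimension-2 P-cone, modulo the clause off the vertex (crux `FInjectiveMacaulayfication`, line H4-gd)

Support file for crux stmt-ResolutionOfSingularities-15315 (`FrobeniusLadder.FInjectiveMacaulayfication`), line (H4-gd), calibration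
G6ᵍ-P (CRUX-PLAN w45a v9 R9.3; seat res-L1-w45a-stub-2, the «G6ᵍ-P assembler»). [OURS · L1 W4.5a] AI-written; AI review is
weaker than expert review. No statement of Hironaka2017 is used; no external fact is consumed.

THE SPECIMEN (res-L1-w45a-idea-2, ANSWERS-r3 §3: the residual point of the STRONG⁺ step `Bl_C` on `f_cusp/𝔽₅`; the first specimen
outside the hypersurface carrier of every earlier engine): `P = V(F₁, F₂) ⊂ 𝔸⁵`, `F₁ = x²+y³−wU`, `F₂ = Z²+wU³+w³`, variables
`(x,y,w,Z,U) = (X 0,…,X 4)`, weights `w = (15,10,18,27,12)` (forced by homogeneity), `N = 540`, `c = (36,54,30,20,45)`.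

THIS FILE assembles every SPECIMEN-INDEPENDENT-OF-`p` input of the graded-domain engine
`GradedDomainConeFiModel.stub_gradedDomainConeFiModel` (p500711) for `P`:
* `hwc` — `0 < w_v`, `c_v·w_v = 540` (`decide`);
* `hpow` — Veronese splitting `PConeVeroneseSplitting.pConeVeroneseSplitting` (p504872);
* homogeneity of `F₁` (weight `30`) and `F₂` (weight `54`);
* primality of `(F₁,F₂)` and `x̄_v ≠ 0` — `PConePrime.pCone_isPrime`, `PConePrime.pCone_X_ne_zero` (over EVERY field);
and leaves exactly ONE hypothesis, the clause at the closed points off the vertex (`hoff`, K-P in the wording of R9.3: «Bad(P) =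
{vertex}»), which is where the characteristic enters (res-L1-w45a-stub-4's `…PConeOffVertex`, `p = 5, 7`): `pConeGradedFiModel_of_offVertex`.
With that file the unconditional calibration is a one-line corollary. No definitions, no named facts. [folklore shape: cone over an
F-injective CM base]
-/

set_option linter.dupNamespace false

open AlgebraicGeometry CategoryTheory Literature.AlgebraicGeometry.Resolution MvPolynomial

namespace Summit.ResolutionOfSingularities.ResolutionOfSingularities.Theorems.FInjectiveMacaulayfication.PConeGradedFiModel

open Summit.ResolutionOfSingularities.ResolutionOfSingularities.Theorems.FInjectiveMacaulayfication

/-- The P-cone weights and chart exponents: `0 < w_v` and `c_v · w_v = 540`. [folklore] -/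
theorem pCone_hwc : ∀ v : Fin 5, 0 < (![15, 10, 18, 27, 12] : Fin 5 → ℕ) v ∧
    (![36, 54, 30, 20, 45] : Fin 5 → ℕ) v * (![15, 10, 18, 27, 12] : Fin 5 → ℕ) v = 540 := by
  decide

/-- `F₁ = x²+y³−wU` is weighted homogeneous of weight `30`. [folklore] -/
theorem isWeightedHomogeneous_F₁ (k : Type) [Field k] (F₁ : MvPolynomial (Fin 5) k)
    (h₁ : F₁ = X 0 ^ 2 + X 1 ^ 3 - X 2 * X 4) :
    MvPolynomial.IsWeightedHomogeneous (![15, 10, 18, 27, 12] : Fin 5 → ℕ) F₁ 30 := by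
  rw [h₁, ← MvPolynomial.mem_weightedHomogeneousSubmodule]
  refine Submodule.sub_mem _ (Submodule.add_mem _ ?_ ?_) ?_ <;> rw [MvPolynomial.mem_weightedHomogeneousSubmodule]
  · simpa using (isWeightedHomogeneous_X k (![15, 10, 18, 27, 12] : Fin 5 → ℕ) 0).pow 2
  · simpa using (isWeightedHomogeneous_X k (![15, 10, 18, 27, 12] : Fin 5 → ℕ) 1).pow 3
  · simpa using (isWeightedHomogeneous_X k (![15, 10, 18, 27, 12] : Fin 5 → ℕ) 2).mul
      (isWeightedHomogeneous_X k (![15, 10, 18, 27, 12] : Fin 5 → ℕ) 4)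

/-- `F₂ = Z²+wU³+w³` is weighted homogeneous of weight `54`. [folklore] -/
theorem isWeightedHomogeneous_F₂ (k : Type) [Field k] (F₂ : MvPolynomial (Fin 5) k)
    (h₂ : F₂ = X 3 ^ 2 + X 2 * X 4 ^ 3 + X 2 ^ 3) :
    MvPolynomial.IsWeightedHomogeneous (![15, 10, 18, 27, 12] : Fin 5 → ℕ) F₂ 54 := by
  rw [h₂]
  refine ((?_ : IsWeightedHomogeneous _ _ 54).add ?_).add ?_
  · simpa using (isWeightedHomogeneous_X k (![15, 10, 18, 27, 12] : Fin 5 → ℕ) 3).pow 2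
  · simpa using (isWeightedHomogeneous_X k (![15, 10, 18, 27, 12] : Fin 5 → ℕ) 2).mul
      ((isWeightedHomogeneous_X k (![15, 10, 18, 27, 12] : Fin 5 → ℕ) 4).pow 3)
  · simpa using (isWeightedHomogeneous_X k (![15, 10, 18, 27, 12] : Fin 5 → ℕ) 2).pow 3

/-- **G6ᵍ-P MODULO THE CLAUSE OFF THE VERTEX.** For every field `k` of characteristic `p`: if `R = k[x,y,w,Z,U]/(F₁,F₂)`
(the P-cone) satisfies the crux clause at every maximal ideal missing some variable, then `Spec R` has a proper birational
model with the crux clause at EVERY point — the weighted blow-up of `I₅₄₀ R` (graded-domain engine p500711 with `hwc` by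
`decide`, `hpow` = `pConeVeroneseSplitting`, homogeneity, `pCone_isPrime`, `pCone_X_ne_zero`). [folklore] -/
theorem pConeGradedFiModel_of_offVertex (p : ℕ) [Fact p.Prime] (k : Type) [Field k] [CharP k p]
    (F₁ F₂ : MvPolynomial (Fin 5) k) (h₁ : F₁ = X 0 ^ 2 + X 1 ^ 3 - X 2 * X 4) (h₂ : F₂ = X 3 ^ 2 + X 2 * X 4 ^ 3 + X 2 ^ 3)
    (hoff : ∀ (Q : Ideal (MvPolynomial (Fin 5) k ⧸ Ideal.span {F₁, F₂})) [Q.IsMaximal],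
      (∃ j : Fin 5, Ideal.Quotient.mk (Ideal.span {F₁, F₂}) (MvPolynomial.X j) ∉ Q) →
      ∀ d : ℕ, ringKrullDim (Localization.AtPrime Q) = d → ∀ s : Fin d → Localization.AtPrime Q,
        (Ideal.span (Set.range s)).radical.IsMaximal →
          RingTheory.Sequence.IsWeaklyRegular (Localization.AtPrime Q) (List.ofFn s) ∧
          ∀ y : Localization.AtPrime Q, (∃ e : ℕ, y ^ p ^ e ∈ Ideal.span
            ((fun z : Localization.AtPrime Q => z ^ p ^ e) ''
              (Ideal.span (Set.range s) : Set (Localization.AtPrime Q)))) → y ∈ Ideal.span (Set.range s)) :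
    ∃ (X' : Scheme.{0}) (π : X' ⟶ Spec (.of (MvPolynomial (Fin 5) k ⧸ Ideal.span {F₁, F₂}))), IsProper π ∧
      Literature.AlgebraicGeometry.Resolution.IsBirational π ∧
      ∀ y : X', IsDomain (X'.presheaf.stalk y) ∧ ∀ d : ℕ, ringKrullDim (X'.presheaf.stalk y) = d →
        ∀ s : Fin d → X'.presheaf.stalk y, (Ideal.span (Set.range s)).radical.IsMaximal →
          RingTheory.Sequence.IsWeaklyRegular (X'.presheaf.stalk y) (List.ofFn s) ∧
          ∀ z : X'.presheaf.stalk y, (∃ e : ℕ, z ^ p ^ e ∈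
              Ideal.span ((fun w : X'.presheaf.stalk y => w ^ p ^ e) ''
                (Ideal.span (Set.range s) : Set (X'.presheaf.stalk y)))) →
            z ∈ Ideal.span (Set.range s) :=
  GradedDomainConeFiModel.stub_gradedDomainConeFiModel p k 5 (![15, 10, 18, 27, 12]) 540 (![36, 54, 30, 20, 45])
    (by norm_num) pCone_hwc (PConeVeroneseSplitting.pConeVeroneseSplitting k) {F₁, F₂}
    (by
      rintro g (rfl | rfl)
      · exact ⟨30, isWeightedHomogeneous_F₁ k _ h₁⟩
      · exact ⟨54, isWeightedHomogeneous_F₂ k _ h₂⟩)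
    (PConePrime.pCone_isPrime F₁ F₂ h₁ h₂) (PConePrime.pCone_X_ne_zero F₁ F₂ h₁ h₂) hoff

end Summit.ResolutionOfSingularities.ResolutionOfSingularities.Theorems.FInjectiveMacaulayfication.PConeGradedFiModel
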